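import Literature.Computability.QuantumComplexity.ApproxBosonSamplingIdealSide
import Literature.Computability.QuantumComplexity.ApproxBosonSamplingMachines
import Literature.MeasureTheory.TotalVariation.SetwiseBound
import HarnessLib

/-!
# Approximate BosonSampling: the real side of Aaronson–Arkhipov's proof of Thm. 1.3

Family `quantum-advantage`; sequel of `ApproxBosonSamplingAccounting.lean` (the accounting,
eqs. (5.78)–(5.97)), `ApproxBosonSamplingIdealSide.lean` (the analysis on the ideal process `A` Haar,
`S*` uniform) and `ApproxBosonSamplingMachines.lean` (the coin predicate of the oracle is in `P^𝒪`).
Source: S. Aaronson, A. Arkhipov, *The computational complexity of linear optics*, Theory of Computing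
9 (2013) 143–252 (AA13), Thm. 1.3 (p. 152), proof §5.2 (pp. 192–195) with Lemma 5.8 (p. 191) and
Thm. 5.1 (p. 183).

This file completes the **probabilistic part of the proof of Thm. 1.3 in the tree's model**, relative
to an explicit interface for the one ingredient whose printed form is not finite-precision — the
Hiding Lemma 5.8:

* `IsHidingSampler H ℓ₁ b₀` — the **finite-precision Hiding Lemma as a spec**: a string function `H`
  (input `⟨⟨n, e, b, b', round_b X⟩, u₁⟩`, output the code of `round_{b'} A` and the planted outcome)
  together with a *ghost pair* `(A, ι)` — an exactly column-orthonormal `A ∈ 𝒰_{n+e,n}` with planted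
  block exactly `X/√(n+e)` at the rows `ι` ((H1), outside a small bad set) — whose law, when
  `X ∼ 𝒮_{n+e,n}` instead of `𝒢^{n×n}`, is EXACTLY the ideal one: `A` the first `n` columns of a Haar
  unitary, `ι` uniform and independent ((H2), Lemma 5.8 (ii) with the symmetry principle of p. 194);
  the machine reproduces the ghost's code except with small probability ((H3)); its coins are uniform
  ((H0)). This is the honest finite-precision content of "a `BPP^{NP}` algorithm … that succeeds with
  probability `1 − O(δ)` … conditioned on succeeding, samples `A ∼ 𝒟_X`" (Lemma 5.8); constructing
  such an `H ∈ FP` is the remaining analytic task (Haar conditional structure, a Gaussian sampler,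
  rounding-boundary estimates).
* `ReductionData.gpeAnswer` — the composite `|GPE|²_±` oracle of the proof as a string function
  (parameters `e = K(n+1)⁷kδ³` extra modes, `kβ = 48kεkδ`, `kη = 32kεkδ`, `kδS = 8kδ`, `kH = 16kδ`,
  `b' = p₀(n + e + kβ)`, precision and coin polynomials `precPoly`, `coinPoly`), with the
  deterministic core `ReductionData.abs_answer_sub_le` (eqs. (5.93)–(5.95) and the final rounding).
* the generic tools of the real side: coin splitting (`sum_vector_add_fields`), (H0) ⇒ product
  probabilities (`prod_real_setOf_coins_eq_avg`), Thm. 5.1 transfer through a common independent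
  factor (`prod_real_le_add_of_tvClose`, via the tree's `TVClose.prod_left_factor`), (H2) transport
  of the bad event to the ideal side (`prod_real_idealBad_eq_avg_haar`).
* **`gpeRandOracleSolves_gpeAnswer`** — the composite oracle solves `|GPE|²_±` jointly over the
  Gaussian input and its coins (`GPERandOracleSolves`), from Thm. 5.1, the oracle's guarantee, a hiding
  sampler, a Stockmeyer counter and the coin-demand bound; budget `7/(8kδ) < 1/kδ`.
* **`gpeSolvableInFBPPRel_of_hidingSampler`** — hence `|GPE|²_± ∈ FBPP^{NP^𝒪}` (the conclusion of
  the named fact `gpeSolvableInFBPPRel_NPRel_of_approxBosonSamplingOracle`) from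
  `haarUnitaryTruncation_tv`, `stockmeyerApproxCounting` (proved in the tree), a hiding sampler in
  `FP`, and two machine facts (the counter's coin demand is polynomially bounded over orthonormal
  hidden matrices — an encoding-length statement — and the composite is in `FP^{L}`).

All proved; no new named facts (the remaining ingredients are hypotheses of the two final theorems).

## References

* S. Aaronson, A. Arkhipov, *The computational complexity of linear optics*, Theory of Computing 9
  (2013) 143–252: Thm. 1.3 (p. 152), §5.2 (pp. 192–195), Lemma 5.8 (p. 191), Thm. 5.1 (p. 183),
  Thm. 4.1 (p. 175), Def. 3.11 (p. 174), §2 (p. 161, finite precision).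
-/

open MeasureTheory Matrix Finset Computability Literature.Computability.Cryptography
  Literature.Computability.Complexity Literature.MeasureTheory.TotalVariation
open scoped ENNReal

namespace Literature.Computability.QuantumComplexity

variable {n e : ℕ}

/-! ### I/O conventions of the hiding sampler -/

/-- Input of the hiding sampler: `⟨⟨n, e, b, b', X̃⟩, u₁⟩` — the dimension, the number of extra modes,
the input precision `b` of `X̃ = round_b X`, the requested output precision `b'`, the rounded
Gaussian matrix, and the coin block `u₁` (wire format of `encodeGPEQuery`). [folklore] -/
def hidingInput (n e b b' : ℕ) (Xt : Fin n → Fin n → ℤ × ℤ) (u₁ : List Bool) : List Bool :=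
  boolPair (encodeGPEQuery ⟨n, e, b, b', Xt⟩) u₁

/-- Expected output of the hiding sampler for the ghost pair `(A, ι)`: the BosonSampling instance
code of `round_{b'} A` and the planted outcome `S*_ι`. [folklore] -/
noncomputable def hidingOutput (n e b' : ℕ) (A : Matrix (Fin (n + e)) (Fin n) ℂ)
    (ι : Fin n ↪ Fin (n + e)) : List Bool :=
  boolPair (encodingBosonInput.encode ⟨n, e, b', roundEntries b' A⟩) (plantedOutcome ι)

/-! ### The spec of a finite-precision Hiding Lemma (AA13 Lemma 5.8, tree form) -/

/-- `IsHidingSampler H ℓ₁ b₀`: the string function `H` (to be shown `∈ FP` separately) is a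
**finite-precision hiding sampler** with coin polynomial `ℓ₁` and input-precision threshold `b₀`:
for all dimensions `1 ≤ n ≤ e`, confidence `kH ≥ 1`, output precision `b'` and input precision
`b ≥ b₀(n + e + b' + kH)`, there are an auxiliary probability space `(𝒱, ν)` carrying the sampler's
coins `coins : 𝒱 → {0,1}^{ℓ₁(…)}` (uniformly distributed, (H0)), a *ghost* `A : ℂ^{n×n} → 𝒱 → 𝒰_{n+e,n}`
and a planted position `ι : 𝒱 → (Fin n ↪ Fin (n+e))`, jointly measurable, and a bad set, such that
(H1) outside the bad set (of `𝒢 ⊗ ν`-measure `≤ 1/kH`) the ghost is column-orthonormal with planted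
block exactly `X/√(n+e)`; (H2) when `X ∼ 𝒮_{n+e,n}` instead of `𝒢`, the pair `(A X v, ι v)` has
EXACTLY the ideal law — `A` distributed as the first `n` columns of a Haar unitary, `ι` uniform and
independent — written position by position on measurable sets of entry arrays; (H3) on input
`⟨⟨n,e,b,b',round_b X⟩, coins v⟩` the sampler outputs the code of `round_{b'}(A X v)` and `S*_{ι v}`
except with `𝒢 ⊗ ν`-probability `≤ 1/kH`. (AA13 Lemma 5.8 (i)–(ii), p. 191, in the finite-precision
reading of §2 p. 161; the ghost/coupling formulation replaces "succeeds with probability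
`1 − O(δ)` … conditioned on succeeding, samples `A ∼ 𝒟_X`".)
[cite: AaronsonArkhipovToC2013, Lemma 5.8 (p. 191) with §2 (p. 161)] -/
def IsHidingSampler (H : List Bool → List Bool) (ℓ₁ b₀ : Polynomial ℕ) : Prop :=
  ∀ (n e b b' kH : ℕ) (h : n ≤ n + e), 1 ≤ n → n ≤ e → 0 < kH → b₀.eval (n + e + b' + kH) ≤ b →
    ∃ (𝒱 : Type) (_ : MeasurableSpace 𝒱) (ν : Measure 𝒱) (_ : IsProbabilityMeasure ν)
      (coins : 𝒱 → List.Vector Bool (ℓ₁.eval (n + e + b + b' + kH)))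
      (A : (Fin n → Fin n → ℂ) → 𝒱 → Matrix (Fin (n + e)) (Fin n) ℂ)
      (ι : 𝒱 → (Fin n ↪ Fin (n + e)))
      (Bad : Set ((Fin n → Fin n → ℂ) × 𝒱)),
      -- (H0) the coins are uniform bits; measurability of the data
      (∀ u, MeasurableSet {v | coins v = u} ∧
          ν.real {v | coins v = u} = 1 / 2 ^ (ℓ₁.eval (n + e + b + b' + kH))) ∧
      (Measurable fun p : (Fin n → Fin n → ℂ) × 𝒱 =>
          (fun i j => A p.1 p.2 i j : Fin (n + e) → Fin n → ℂ)) ∧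
      (∀ ι₀, MeasurableSet {v | ι v = ι₀}) ∧ MeasurableSet Bad ∧
      -- (H1) exact planting into a column-orthonormal ghost, outside a small bad set
      (∀ p : (Fin n → Fin n → ℂ) × 𝒱, p ∉ Bad →
          IsColumnOrthonormal (A p.1 p.2) ∧
            (A p.1 p.2).submatrix (ι p.2) id = ((Real.sqrt (n + e : ℕ))⁻¹ : ℝ) • Matrix.of p.1) ∧
      ((gaussianMatrixMeasure n).prod ν).real Bad ≤ 1 / (kH : ℝ) ∧
      -- (H2) symmetry: under `X ∼ 𝒮_{n+e,n}` the ghost pair has the ideal law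
      (∀ (ι₀ : Fin n ↪ Fin (n + e)) (T : Set (Fin (n + e) → Fin n → ℂ)), MeasurableSet T →
          ((truncatedHaarMeasure (n + e) n h).prod ν).real
              {p | (fun i j => A p.1 p.2 i j : Fin (n + e) → Fin n → ℂ) ∈ T ∧ ι p.2 = ι₀} =
            (Literature.MathematicalPhysics.QuantumFieldTheory.haarProbability
                (Matrix.unitaryGroup (Fin (n + e)) ℂ)).real
              {U | (fun i j => firstCols h U i j : Fin (n + e) → Fin n → ℂ) ∈ T} /
              Fintype.card (Fin n ↪ Fin (n + e))) ∧
      -- (H3) fidelity of the machine to the ghost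
      ((gaussianMatrixMeasure n).prod ν).real
          {p | H (hidingInput n e b b' (roundMatrix b (Matrix.of p.1)) (coins p.2).toList) ≠
              hidingOutput n e b' (A p.1 p.2) (ι p.2)} ≤ 1 / (kH : ℝ)

/-! ### Generic probability tools of the real side -/

section Tools

/-- Splitting a coin string of length `a + b` into its two fields. [folklore] -/
private def vecSplitEquiv (a b : ℕ) :
    List.Vector Bool (a + b) ≃ List.Vector Bool a × List.Vector Bool b where
  toFun v := (⟨v.toList.take a, by simp⟩, ⟨v.toList.drop a, by simp⟩)
  invFun q := ⟨q.1.toList ++ q.2.toList, by simp⟩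
  left_inv v := by
    apply Subtype.ext
    show List.take a v.toList ++ List.drop a v.toList = v.toList
    exact List.take_append_drop a v.toList
  right_inv q := by
    obtain ⟨⟨u, hu⟩, ⟨w, hw⟩⟩ := q
    refine Prod.ext (Subtype.ext ?_) (Subtype.ext ?_)
    · show List.take a (u ++ w) = u
      exact List.take_left' hu
    · show List.drop a (u ++ w) = w
      exact List.drop_left' hu

/-- **Splitting a sum over `{0,1}^{a+b}`** into iterated sums over `{0,1}^a` and `{0,1}^b` (the coin
string read as two consecutive fields). Private copy of `Literature.Computability.Cryptography.sum_vector_add`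
(`LiuPassPadding.lean`, whose Liu–Pass import chain is not wanted here). [folklore] -/
private theorem sum_vector_add_fields {M : Type*} [AddCommMonoid M] (a b : ℕ)
    (φ : List Bool → List Bool → M) :
    ∑ v : List.Vector Bool (a + b), φ (v.toList.take a) (v.toList.drop a) =
      ∑ u : List.Vector Bool a, ∑ w : List.Vector Bool b, φ u.toList w.toList := by
  rw [← Fintype.sum_prod_type' (f := fun (u : List.Vector Bool a) (w : List.Vector Bool b) =>
    φ u.toList w.toList)]
  exact Fintype.sum_equiv (vecSplitEquiv a b) _ _ fun v => rfl

/-- Sums over coin strings depend only on the length (transport along `a = b`). Private copy of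
`GLHardCore.sum_vector_cast` (`CryptoFoundationsOneWayFunctionsS24Proofs.lean`, not imported for the
same reason). [folklore] -/
private theorem sum_vector_congr {M : Type*} [AddCommMonoid M] {a b : ℕ} (hab : a = b)
    (g : List Bool → M) :
    ∑ v : List.Vector Bool a, g v.toList = ∑ v : List.Vector Bool b, g v.toList := by
  subst hab
  rfl

variable {𝒳 𝒱 : Type*} [MeasurableSpace 𝒳] [MeasurableSpace 𝒱]

/-- **(H0) turns coin averages into product probabilities.** If `coins : 𝒱 → {0,1}^L` has
measurable level sets of `ν`-mass `2^{-L}` each, then for measurable events `S u ⊆ 𝒳` the average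
over `u` of `μ(S u)` is the `μ ⊗ ν`-probability that `x ∈ S (coins v)`. [folklore] -/
theorem prod_real_setOf_coins_eq_avg (μ : Measure 𝒳) [IsFiniteMeasure μ] (ν : Measure 𝒱)
    [IsProbabilityMeasure ν] {L : ℕ} (coins : 𝒱 → List.Vector Bool L)
    (hmeas : ∀ u, MeasurableSet {v | coins v = u})
    (hunif : ∀ u, ν.real {v | coins v = u} = 1 / 2 ^ L)
    (S : List.Vector Bool L → Set 𝒳) (hS : ∀ u, MeasurableSet (S u)) :
    (μ.prod ν).real {p : 𝒳 × 𝒱 | p.1 ∈ S (coins p.2)} =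
      (∑ u : List.Vector Bool L, μ.real (S u)) / 2 ^ L := by
  classical
  have hset : {p : 𝒳 × 𝒱 | p.1 ∈ S (coins p.2)} =
      ⋃ u ∈ (Finset.univ : Finset (List.Vector Bool L)), S u ×ˢ {v | coins v = u} := by
    ext p
    simp only [Set.mem_setOf_eq, Set.mem_iUnion, Set.mem_prod, exists_prop, Finset.mem_univ,
      true_and]
    constructor
    · intro hp
      exact ⟨coins p.2, hp, rfl⟩
    · rintro ⟨u, hp, hu⟩
      rw [hu]
      exact hp
  have hdisj : Set.PairwiseDisjoint (↑(Finset.univ : Finset (List.Vector Bool L)))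
      fun u => S u ×ˢ {v | coins v = u} := by
    intro u _ u' _ huu'
    refine Set.disjoint_left.2 fun p hp hp' => huu' ?_
    simp only [Set.mem_prod, Set.mem_setOf_eq] at hp hp'
    rw [← hp.2, ← hp'.2]
  rw [hset, measureReal_biUnion_finset hdisj (fun u _ => (hS u).prod (hmeas u))]
  rw [Finset.sum_div]
  refine Finset.sum_congr rfl fun u _ => ?_
  rw [measureReal_prod_prod, hunif u]
  ring

/-- **Thm. 5.1 transfer.** If `μ` and `μ'` are `η`-close on all measurable sets
(`TVClose μ μ' η`, e.g. `𝒢^{n×n}` and `𝒮_{m,n}` by `haarUnitaryTruncation_tv`), then for every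
measurable event of `𝒳 × 𝒱`, `(μ ⊗ ν)(E) ≤ (μ' ⊗ ν)(E) + η` (`TVClose.prod_left_factor`).
[cite: AaronsonArkhipovToC2013, Thm. 5.1 (p. 183) as used in Lemma 5.8 / Thm. 1.3] -/
theorem prod_real_le_add_of_tvClose {μ μ' : Measure 𝒳} [IsProbabilityMeasure μ]
    [IsProbabilityMeasure μ'] (ν : Measure 𝒱) [IsProbabilityMeasure ν] {η : ℝ}
    (hclose : TVClose μ μ' η) {E : Set (𝒳 × 𝒱)} (hE : MeasurableSet E) :
    (μ.prod ν).real E ≤ (μ'.prod ν).real E + η := by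
  have h := hclose.prod_left_factor ν E hE
  rw [abs_le] at h
  linarith [h.2]

/-- `haarUnitaryTruncation_tv` in `TVClose` form: `‖𝒢^{n×n} − 𝒮_{m,n}‖ ≤ Cδ` on all measurable
sets. [cite: AaronsonArkhipovToC2013, Thm. 5.1 (p. 183)] -/
theorem tvClose_gaussian_truncatedHaar {C δ₀ : ℝ}
    (hC : ∀ (n m : ℕ) (h : n ≤ m) (δ : ℝ), 1 ≤ n → 0 < δ → δ ≤ δ₀ →
      (n : ℝ) ^ 5 / δ * Real.log (n / δ) ^ 2 ≤ m →
      ∀ E : Set (Fin n → Fin n → ℂ), MeasurableSet E →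
        |(truncatedHaarMeasure m n h).real E - (gaussianMatrixMeasure n).real E| ≤ C * δ)
    {n m : ℕ} (h : n ≤ m) {δ : ℝ} (hn : 1 ≤ n) (hδ : 0 < δ) (hδ₀ : δ ≤ δ₀)
    (hm : (n : ℝ) ^ 5 / δ * Real.log (n / δ) ^ 2 ≤ m) :
    TVClose (gaussianMatrixMeasure n) (truncatedHaarMeasure m n h) (C * δ) := by
  intro E hE
  rw [abs_sub_comm]
  exact hC n m h δ hn hδ hδ₀ hm E hE

end Tools

/-! ### (H2) transports the bad event to the ideal side -/

/-- **Symmetry transport.** Under (H2) — position by position, the joint law of the entries of the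
ghost and of the planted position under `𝒮 ⊗ ν` is the ideal law — the `𝒮 ⊗ ν`-probability of the
bad event of the union bound equals the `(u₂-section of the) ideal-side average of
`avg_haar_idealBad_le`: `∑_{ι₀} Haar{U | idealBad (firstCols U) ι₀ u₂} / |positions|`.
[cite: AaronsonArkhipovToC2013, proof of Thm. 1.3, symmetry principle (p. 194) with Lemma 5.8 (ii) (p. 191)] -/
theorem prod_real_idealBad_eq_avg_haar {𝒱 : Type*} [MeasurableSpace 𝒱] (h : n ≤ n + e)
    (S : Measure (Fin n → Fin n → ℂ)) (ν : Measure 𝒱) [IsFiniteMeasure (S.prod ν)]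
    (A : (Fin n → Fin n → ℂ) → 𝒱 → Matrix (Fin (n + e)) (Fin n) ℂ)
    (ι : 𝒱 → (Fin n ↪ Fin (n + e)))
    (hA : Measurable fun p : (Fin n → Fin n → ℂ) × 𝒱 =>
      (fun i j => A p.1 p.2 i j : Fin (n + e) → Fin n → ℂ))
    (hι : ∀ ι₀, MeasurableSet {v | ι v = ι₀})
    (hH2 : ∀ (ι₀ : Fin n ↪ Fin (n + e)) (T : Set (Fin (n + e) → Fin n → ℂ)), MeasurableSet T →
      (S.prod ν).real {p | (fun i j => A p.1 p.2 i j : Fin (n + e) → Fin n → ℂ) ∈ T ∧ ι p.2 = ι₀} =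
        (Literature.MathematicalPhysics.QuantumFieldTheory.haarProbability
            (Matrix.unitaryGroup (Fin (n + e)) ℂ)).real
          {U | (fun i j => firstCols h U i j : Fin (n + e) → Fin n → ℂ) ∈ T} /
          Fintype.card (Fin n ↪ Fin (n + e)))
    (P : IdealParams) (ε δ : ℝ) (u₂ : List Bool) :
    (S.prod ν).real {p | idealBad P ε δ (A p.1 p.2) (ι p.2) u₂} =
      (∑ ι₀ : Fin n ↪ Fin (n + e),
        (Literature.MathematicalPhysics.QuantumFieldTheory.haarProbability
            (Matrix.unitaryGroup (Fin (n + e)) ℂ)).real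
          {U | idealBad P ε δ (firstCols h U) ι₀ u₂}) / Fintype.card (Fin n ↪ Fin (n + e)) := by
  classical
  set T : (Fin n ↪ Fin (n + e)) → Set (Fin (n + e) → Fin n → ℂ) :=
    fun ι₀ => {a | idealBad P ε δ (Matrix.of a) ι₀ u₂} with hT
  have hTm : ∀ ι₀, MeasurableSet (T ι₀) := fun ι₀ => measurableSet_idealBad_of P ε δ ι₀ u₂
  -- partition the bad event by the planted position
  have hset : {p : (Fin n → Fin n → ℂ) × 𝒱 | idealBad P ε δ (A p.1 p.2) (ι p.2) u₂} =
      ⋃ ι₀ ∈ (Finset.univ : Finset (Fin n ↪ Fin (n + e))),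
        {p | (fun i j => A p.1 p.2 i j : Fin (n + e) → Fin n → ℂ) ∈ T ι₀ ∧ ι p.2 = ι₀} := by
    ext p
    simp only [Set.mem_setOf_eq, Set.mem_iUnion, exists_prop, Finset.mem_univ, true_and, hT]
    constructor
    · intro hp
      exact ⟨ι p.2, hp, rfl⟩
    · rintro ⟨ι₀, hp, hι₀⟩
      rw [hι₀]
      exact hp
  have hdisj : Set.PairwiseDisjoint (↑(Finset.univ : Finset (Fin n ↪ Fin (n + e))))
      fun ι₀ => {p : (Fin n → Fin n → ℂ) × 𝒱 |
        (fun i j => A p.1 p.2 i j : Fin (n + e) → Fin n → ℂ) ∈ T ι₀ ∧ ι p.2 = ι₀} := by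
    intro ι₀ _ ι₁ _ hne
    refine Set.disjoint_left.2 fun p hp hp' => hne ?_
    simp only [Set.mem_setOf_eq] at hp hp'
    rw [← hp.2, ← hp'.2]
  have hpiece : ∀ ι₀, MeasurableSet {p : (Fin n → Fin n → ℂ) × 𝒱 |
      (fun i j => A p.1 p.2 i j : Fin (n + e) → Fin n → ℂ) ∈ T ι₀ ∧ ι p.2 = ι₀} := by
    intro ι₀
    refine MeasurableSet.inter (hA (hTm ι₀)) ?_
    exact measurable_snd (hι ι₀)
  rw [hset, measureReal_biUnion_finset hdisj (fun ι₀ _ => hpiece ι₀), Finset.sum_div]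
  refine Finset.sum_congr rfl fun ι₀ _ => ?_
  rw [hH2 ι₀ (T ι₀) (hTm ι₀)]
  rfl

/-- The bad event of the union bound, read on the ghost pair, is a measurable subset of
`ℂ^{n×n} × 𝒱` (union over the finitely many positions of measurable pieces). [folklore] -/
theorem measurableSet_idealBad_prod {𝒱 : Type*} [MeasurableSpace 𝒱]
    (A : (Fin n → Fin n → ℂ) → 𝒱 → Matrix (Fin (n + e)) (Fin n) ℂ)
    (ι : 𝒱 → (Fin n ↪ Fin (n + e)))
    (hA : Measurable fun p : (Fin n → Fin n → ℂ) × 𝒱 =>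
      (fun i j => A p.1 p.2 i j : Fin (n + e) → Fin n → ℂ))
    (hι : ∀ ι₀, MeasurableSet {v | ι v = ι₀}) (P : IdealParams) (ε δ : ℝ) (u₂ : List Bool) :
    MeasurableSet {p : (Fin n → Fin n → ℂ) × 𝒱 | idealBad P ε δ (A p.1 p.2) (ι p.2) u₂} := by
  classical
  have hset : {p : (Fin n → Fin n → ℂ) × 𝒱 | idealBad P ε δ (A p.1 p.2) (ι p.2) u₂} =
      ⋃ ι₀ : Fin n ↪ Fin (n + e),
        {p | (fun i j => A p.1 p.2 i j : Fin (n + e) → Fin n → ℂ) ∈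
            {a : Fin (n + e) → Fin n → ℂ | idealBad P ε δ (Matrix.of a) ι₀ u₂} ∧ ι p.2 = ι₀} := by
    ext p
    simp only [Set.mem_setOf_eq, Set.mem_iUnion]
    constructor
    · intro hp
      exact ⟨ι p.2, hp, rfl⟩
    · rintro ⟨ι₀, hp, hι₀⟩
      rw [hι₀]
      exact hp
  rw [hset]
  refine MeasurableSet.iUnion fun ι₀ => ?_
  exact (hA (measurableSet_idealBad_of P ε δ ι₀ u₂)).inter (measurable_snd (hι ι₀))

/-! ### The composite `|GPE|²_±` oracle of the proof of Thm. 1.3 (as a string function) -/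

/-- The black boxes and parameter constants of the reduction: the oracle's polynomials `p₀, c`
(Def. 3.11), the constant `K` fixing the number of extra modes (from the constants of Thm. 5.1),
the hiding sampler `H` with its polynomials, the Stockmeyer counter `F` with its coin polynomial
(Thm. 4.1), and a polynomial bound `LS` on the counter's coin demand. [cite: AaronsonArkhipovToC2013, proof of Thm. 1.3 (pp. 192–195)] -/
structure ReductionData where
  /-- the approximate BosonSampling oracle -/
  𝒪 : Oracle
  /-- its precision threshold and coin polynomials -/
  p₀ : Polynomial ℕ
  c : Polynomial ℕ
  /-- extra modes: `e = K · (n+1)^7 · kδ^3` -/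
  K : ℕ
  /-- the hiding sampler and its polynomials -/
  H : List Bool → List Bool
  ℓ₁ : Polynomial ℕ
  b₀ : Polynomial ℕ
  /-- the Stockmeyer counter and its coin polynomial -/
  F : List Bool → List Bool
  cS : Polynomial ℕ
  /-- a polynomial bound on the counter's coin demand, in `n + e + b' + kβ + kη + kδS` -/
  LS : Polynomial ℕ

namespace ReductionData

variable (R : ReductionData)

/-- Number of extra modes `e(n, kδ)` (`m = n + e ≥ (n⁵/δ_h) log²(n/δ_h)`, `3n² ≤ m`). [folklore] -/
def extra (n kδ : ℕ) : ℕ := R.K * (n + 1) ^ 7 * kδ ^ 3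

/-- Query accuracy `kβ = 48 kε kδ` (`β = ε₁δ₁/24` with `ε₁ = 1/(2kε)`, `δ₁ = 1/kδ`). [folklore] -/
def kβ (kε kδ : ℕ) : ℕ := 48 * kε * kδ

/-- Stockmeyer accuracy `kη = 32 kε kδ` (`α = ε₁δ₁/16`). [folklore] -/
def kη (kε kδ : ℕ) : ℕ := 32 * kε * kδ

/-- Stockmeyer confidence `kδS = 8 kδ`. [folklore] -/
def kδS (kδ : ℕ) : ℕ := 8 * kδ

/-- Hiding confidence `kH = 16 kδ`. [folklore] -/
def kH (kδ : ℕ) : ℕ := 16 * kδ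

/-- Query precision `b' = p₀(n + e + kβ)`. [folklore] -/
def bq (n kε kδ : ℕ) : ℕ := R.p₀.eval (n + R.extra n kδ + kβ kε kδ)

/-- A polynomial bound on the number of extra modes in `s = n + kε + kδ`. [folklore] -/
noncomputable def polyE : Polynomial ℕ := Polynomial.C R.K * (Polynomial.X + 1) ^ 7 * Polynomial.X ^ 3

/-- A polynomial bound on the query precision `b'` in `s`. [folklore] -/
noncomputable def polyBq : Polynomial ℕ := R.p₀.comp (Polynomial.X + R.polyE + 48 * Polynomial.X ^ 2)

/-- **The input precision polynomial** `p` of `GPERandOracleSolves`: `b = p(s) ≥ s` and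
`b ≥ b₀(n + e + b' + kH)`. [folklore] -/
noncomputable def precPoly : Polynomial ℕ :=
  Polynomial.X + R.b₀.comp (Polynomial.X + R.polyE + R.polyBq + 16 * Polynomial.X)

/-- A polynomial bound on the sampler's coin count in `s`. [folklore] -/
noncomputable def polyL1 : Polynomial ℕ :=
  R.ℓ₁.comp (Polynomial.X + R.polyE + R.precPoly + R.polyBq + 16 * Polynomial.X)

/-- A polynomial bound on the counter's coin demand in `s`. [folklore] -/
noncomputable def polyL2 : Polynomial ℕ :=
  R.LS.comp (Polynomial.X + R.polyE + R.polyBq + 48 * Polynomial.X ^ 2 + 32 * Polynomial.X ^ 2 +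
    8 * Polynomial.X)

/-- **The coin polynomial** `c` of `GPERandOracleSolves`. [folklore] -/
noncomputable def coinPoly : Polynomial ℕ := R.polyL1 + R.polyL2

/-- The sampler's coin count at the actual parameters. [folklore] -/
def coinLen₁ (n b kε kδ : ℕ) : ℕ :=
  R.ℓ₁.eval (n + R.extra n kδ + b + R.bq n kε kδ + kH kδ)

/-- The counter's coin block: all coins after the sampler's. [folklore] -/
noncomputable def coinLen₂ (n b kε kδ : ℕ) : ℕ :=
  R.coinPoly.eval (n + kε + kδ) - R.coinLen₁ n b kε kδ

/-- The ideal-side parameter record at `(n, b, kε, kδ)`. [folklore] -/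
noncomputable def idealParams (n b kε kδ : ℕ) : IdealParams :=
  ⟨R.𝒪, R.c, R.bq n kε kδ, kβ kε kδ, R.F, R.cS, kη kε kδ, kδS kδ, R.coinLen₂ n b kε kδ⟩

/-- The oracle's coin length `ℓ` read off the sampler's output `out = ⟨x_Q, y⟩` (padded query
`⟨x_Q, 1^{kβ}⟩`). [folklore] -/
def coinLenOfOutput (kε kδ : ℕ) (out : List Bool) : ℕ :=
  R.c.eval (boolPair (boolUnpair out).1 (unaryEncodeNat (kβ kε kδ))).length

/-- The count estimate `Ñ` computed from the sampler's output and the counter's coin block. [folklore] -/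
def countOfOutput (kε kδ : ℕ) (out u₂ : List Bool) : ℕ :=
  countEstimate R.F (boolPair (boolPair (boolUnpair out).1 (unaryEncodeNat (kβ kε kδ))) (boolUnpair out).2)
    (R.coinLenOfOutput kε kδ out) (kη kε kδ) (kδS kδ)
    (u₂.take (R.cS.eval ((boolPair (boolPair (boolUnpair out).1 (unaryEncodeNat (kβ kε kδ)))
      (boolUnpair out).2).length + R.coinLenOfOutput kε kδ out + kη kε kδ + kδS kδ)))

/-- The rescaled real-valued estimate `4^b · n! · (n+e)ⁿ · Ñ / 2^ℓ` from the sampler's output and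
the counter's coins. [folklore] -/
noncomputable def rescaledOfOutput (n b kε kδ : ℕ) (out u₂ : List Bool) : ℝ :=
  (4 : ℝ) ^ b * ((n.factorial : ℝ) * ((n + R.extra n kδ : ℕ) : ℝ) ^ n *
    ((R.countOfOutput kε kδ out u₂ : ℝ) / 2 ^ R.coinLenOfOutput kε kδ out))

/-- **The integer answer of the composite oracle** on the query `⟨n, b, kε, kδ, X̃⟩` with coins `r`:
run the hiding sampler on `⟨⟨n, e, b, b', X̃⟩, u₁⟩` (`u₁` = first `ℓ₁(…)` coins), run the
Stockmeyer counter on its output with the remaining coins, and return the integer nearest to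
`4^b · n! · (n+e)ⁿ · Ñ / 2^ℓ`; for `n = 0` return `4^b` (`Per` of the empty matrix is `1`).
[cite: AaronsonArkhipovToC2013, proof of Thm. 1.3 (pp. 192–195)] -/
noncomputable def gpeIntAnswer (n b kε kδ : ℕ) (Xt : Fin n → Fin n → ℤ × ℤ) (r : List Bool) : ℤ :=
  if n = 0 then 4 ^ b
  else
    round (R.rescaledOfOutput n b kε kδ
      (R.H (hidingInput n (R.extra n kδ) b (R.bq n kε kδ) Xt (r.take (R.coinLen₁ n b kε kδ))))
      (r.drop (R.coinLen₁ n b kε kδ)))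

/-- **The composite oracle** as a string function: decode the GPE query, answer with
`gpeIntAnswer` in `encodingIntBool`; malformed queries get `[]`. [cite: AaronsonArkhipovToC2013, proof of Thm. 1.3 (pp. 192–195)] -/
noncomputable def gpeAnswer (w : List Bool) : List Bool :=
  match encodingGPEQuery.decode (boolUnpair w).1 with
  | none => []
  | some ⟨n, b, kε, kδ, Xt⟩ => encodingIntBool.encode (R.gpeIntAnswer n b kε kδ Xt (boolUnpair w).2)

/-- The GPE estimate read off the composite oracle is `gpeIntAnswer`. [folklore] -/
theorem gpeRandOracleEstimate_gpeAnswer (n b kε kδ : ℕ) (Xt : Fin n → Fin n → ℤ × ℤ)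
    (r : List Bool) :
    GPERandOracleEstimate R.gpeAnswer n b kε kδ Xt r = R.gpeIntAnswer n b kε kδ Xt r := by
  unfold GPERandOracleEstimate gpeAnswer
  rw [boolUnpair_boolPair]
  simp only [encodeGPEQuery, Encoding.decode_encode]
  rfl

/-- On the sampler's expected output the computed oracle coin length is the ideal-side one. [folklore] -/
theorem coinLenOfOutput_hidingOutput (n b kε kδ : ℕ) (A : Matrix (Fin (n + R.extra n kδ)) (Fin n) ℂ)
    (ι : Fin n ↪ Fin (n + R.extra n kδ)) :
    R.coinLenOfOutput kε kδ (hidingOutput n (R.extra n kδ) (R.bq n kε kδ) A ι) =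
      (R.idealParams n b kε kδ).oracleCoinLen (roundEntries (R.bq n kε kδ) A) := by
  simp only [coinLenOfOutput, hidingOutput, boolUnpair_boolPair]
  rfl

/-- On the sampler's expected output the computed count is the ideal-side `plantedCountEstimate`.
[folklore] -/
theorem countOfOutput_hidingOutput (n b kε kδ : ℕ) (A : Matrix (Fin (n + R.extra n kδ)) (Fin n) ℂ)
    (ι : Fin n ↪ Fin (n + R.extra n kδ)) (u₂ : List Bool) :
    R.countOfOutput kε kδ (hidingOutput n (R.extra n kδ) (R.bq n kε kδ) A ι) u₂ =
      (R.idealParams n b kε kδ).plantedCountEstimate (roundEntries (R.bq n kε kδ) A) ι u₂ := by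
  simp only [countOfOutput, coinLenOfOutput, hidingOutput, boolUnpair_boolPair]
  rfl

/-- The counter's coin demand of the actual parameter record is that of the `ℓ₂`-free record used
in the hypothesis `hLS` (it does not depend on the supplied coins). [folklore] -/
theorem stockCoinLen_idealParams (n b kε kδ : ℕ) (E : Fin (n + R.extra n kδ) → Fin n → ℤ × ℤ)
    (ι : Fin n ↪ Fin (n + R.extra n kδ)) :
    (R.idealParams n b kε kδ).stockCoinLen E ι =
      (⟨R.𝒪, R.c, R.bq n kε kδ, kβ kε kδ, R.F, R.cS, kη kε kδ, kδS kδ, 0⟩ : IdealParams).stockCoinLen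
        E ι :=
  rfl

/-! ### Elementary bounds on the parameters -/

/-- Evaluation of an `ℕ`-polynomial is monotone in the argument (private copy of
`TM2Iter.eval_mono`). [folklore] -/
private theorem natPoly_eval_mono (q : Polynomial ℕ) {x y : ℕ} (hxy : x ≤ y) :
    q.eval x ≤ q.eval y := by
  induction q using Polynomial.induction_on' with
  | add p q hp hq => simp only [Polynomial.eval_add]; exact Nat.add_le_add hp hq
  | monomial k a =>
    simp only [Polynomial.eval_monomial]
    exact Nat.mul_le_mul_left a (Nat.pow_le_pow_left hxy k)

/-- `e ≤ polyE(s)`. [folklore] -/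
theorem extra_le_polyE (n kε kδ : ℕ) : R.extra n kδ ≤ R.polyE.eval (n + kε + kδ) := by
  simp only [extra, polyE, Polynomial.eval_mul, Polynomial.eval_C, Polynomial.eval_pow,
    Polynomial.eval_add, Polynomial.eval_X, Polynomial.eval_one]
  gcongr <;> omega

/-- `kβ ≤ 48 s²`. [folklore] -/
theorem kβ_le (n kε kδ : ℕ) : kβ kε kδ ≤ 48 * (n + kε + kδ) ^ 2 := by
  unfold kβ
  nlinarith [Nat.zero_le kε, Nat.zero_le kδ, Nat.zero_le n]

/-- `b' ≤ polyBq(s)`. [folklore] -/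
theorem bq_le_polyBq (n kε kδ : ℕ) : R.bq n kε kδ ≤ R.polyBq.eval (n + kε + kδ) := by
  unfold bq polyBq
  rw [Polynomial.eval_comp]
  refine natPoly_eval_mono _ ?_
  simp only [Polynomial.eval_add, Polynomial.eval_X, Polynomial.eval_mul, Polynomial.eval_pow,
    Polynomial.eval_ofNat]
  have h1 := R.extra_le_polyE n kε kδ
  have h2 := kβ_le n kε kδ
  omega

/-- `kH ≤ 16 s`. [folklore] -/
theorem kH_le (n kε kδ : ℕ) : kH kδ ≤ 16 * (n + kε + kδ) := by unfold kH; omega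

/-- `kη ≤ 32 s²`. [folklore] -/
theorem kη_le (n kε kδ : ℕ) : kη kε kδ ≤ 32 * (n + kε + kδ) ^ 2 := by
  unfold kη; nlinarith [Nat.zero_le kε, Nat.zero_le kδ, Nat.zero_le n]

/-- `kδS ≤ 8 s`. [folklore] -/
theorem kδS_le (n kε kδ : ℕ) : kδS kδ ≤ 8 * (n + kε + kδ) := by unfold kδS; omega

/-- **The precision polynomial meets the sampler's threshold**: `b₀(n + e + b' + kH) ≤ b = p(s)` and
`s ≤ b`. [folklore] -/
theorem b₀_le_precPoly (n kε kδ : ℕ) :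
    R.b₀.eval (n + R.extra n kδ + R.bq n kε kδ + kH kδ) ≤ R.precPoly.eval (n + kε + kδ) := by
  unfold precPoly
  rw [Polynomial.eval_add, Polynomial.eval_X, Polynomial.eval_comp]
  refine le_add_left (natPoly_eval_mono _ ?_)
  simp only [Polynomial.eval_add, Polynomial.eval_X, Polynomial.eval_mul, Polynomial.eval_ofNat]
  have h1 := R.extra_le_polyE n kε kδ
  have h2 := R.bq_le_polyBq n kε kδ
  have h3 := kH_le n kε kδ
  omega

/-- `s ≤ p(s)`. [folklore] -/
theorem le_precPoly (n kε kδ : ℕ) : n + kε + kδ ≤ R.precPoly.eval (n + kε + kδ) := by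
  unfold precPoly
  rw [Polynomial.eval_add, Polynomial.eval_X]
  exact Nat.le_add_right _ _

/-- **The sampler's coins fit**: `coinLen₁ ≤ polyL1(s) ≤ coinPoly(s)`. [folklore] -/
theorem coinLen₁_le (n kε kδ : ℕ) :
    R.coinLen₁ n (R.precPoly.eval (n + kε + kδ)) kε kδ ≤ R.polyL1.eval (n + kε + kδ) := by
  unfold coinLen₁ polyL1
  rw [Polynomial.eval_comp]
  refine natPoly_eval_mono _ ?_
  simp only [Polynomial.eval_add, Polynomial.eval_X, Polynomial.eval_mul, Polynomial.eval_ofNat]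
  have h1 := R.extra_le_polyE n kε kδ
  have h2 := R.bq_le_polyBq n kε kδ
  have h3 := kH_le n kε kδ
  omega

/-- `polyL1(s) ≤ c(s)`. [folklore] -/
theorem polyL1_le_coinPoly (s : ℕ) : R.polyL1.eval s ≤ R.coinPoly.eval s := by
  unfold coinPoly; rw [Polynomial.eval_add]; exact Nat.le_add_right _ _

/-- **The counter's coins fit**: `polyL2(s) ≤ coinLen₂` and the demand bound `LS(…) ≤ polyL2(s)`.
[folklore] -/
theorem polyL2_le_coinLen₂ (n kε kδ : ℕ) :
    R.polyL2.eval (n + kε + kδ) ≤ R.coinLen₂ n (R.precPoly.eval (n + kε + kδ)) kε kδ := by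
  unfold coinLen₂ coinPoly
  rw [Polynomial.eval_add]
  have := R.coinLen₁_le n kε kδ
  omega

/-- The counter's coin demand bound at the actual parameters is below `polyL2(s)`. [folklore] -/
theorem LS_le_polyL2 (n kε kδ : ℕ) :
    R.LS.eval (n + R.extra n kδ + R.bq n kε kδ + kβ kε kδ + kη kε kδ + kδS kδ) ≤
      R.polyL2.eval (n + kε + kδ) := by
  unfold polyL2
  rw [Polynomial.eval_comp]
  refine natPoly_eval_mono _ ?_
  simp only [Polynomial.eval_add, Polynomial.eval_X, Polynomial.eval_mul, Polynomial.eval_pow,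
    Polynomial.eval_ofNat]
  have h1 := R.extra_le_polyE n kε kδ
  have h2 := R.bq_le_polyBq n kε kδ
  have h3 := kβ_le n kε kδ
  have h4 := kη_le n kε kδ
  have h5 := kδS_le n kε kδ
  omega

end ReductionData

/-! ### The deterministic core on the real side -/

namespace ReductionData

variable (R : ReductionData)

/-- The rounding of the Gaussian input is its entrywise code read as a matrix. [folklore] -/
theorem roundMatrix_of (b : ℕ) (X : Fin n → Fin n → ℂ) :
    roundMatrix b (Matrix.of X) = Matrix.of (fun i j => roundDyadic b (X i j)) :=
  rfl

/-- The entrywise code of the Gaussian input is measurable. [folklore] -/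
theorem measurable_inputCode (b : ℕ) :
    Measurable fun X : Fin n → Fin n → ℂ => (fun i j => roundDyadic b (X i j) : Fin n → Fin n → ℤ × ℤ) :=
  measurable_pi_iff.2 fun i => measurable_pi_iff.2 fun j =>
    (measurable_roundDyadic b).comp ((measurable_pi_apply j).comp (measurable_pi_apply i))

/-- **The failure event is measurable in the Gaussian input** (for fixed coins): the answer depends
on `X` through its code only, the target `|Per X|²` continuously. [folklore] -/
theorem measurableSet_fail (n b kε kδ : ℕ) (r : List Bool) (t : ℝ) :
    MeasurableSet {X : Fin n → Fin n → ℂ |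
      t < |((R.gpeIntAnswer n b kε kδ (roundMatrix b (Matrix.of X)) r : ℤ) : ℝ) / 4 ^ b -
        ‖(Matrix.of X).permanent‖ ^ 2|} := by
  refine measurableSet_lt measurable_const (Measurable.abs (Measurable.sub ?_ ?_))
  · have h1 : Measurable fun X : Fin n → Fin n → ℂ =>
        ((R.gpeIntAnswer n b kε kδ (Matrix.of (fun i j => roundDyadic b (X i j))) r : ℤ) : ℝ) :=
      (measurable_of_countable fun E : Fin n → Fin n → ℤ × ℤ =>
        ((R.gpeIntAnswer n b kε kδ (Matrix.of E) r : ℤ) : ℝ)).comp (measurable_inputCode b)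
    exact h1.div_const _
  · have hper : Continuous fun X : Fin n → Fin n → ℂ => (Matrix.of X).permanent := by
      unfold Matrix.permanent
      refine continuous_finsetSum _ fun σ _ => continuous_finsetProd _ fun i _ => ?_
      exact (continuous_apply _).comp (continuous_apply _)
    exact ((continuous_norm.comp hper).pow 2).measurable

/-- **The deterministic core on the real side.** If the sampler's output on `⟨…, X̃, u₁⟩` is the code
of a column-orthonormal ghost `A` with planted block `X/√(n+e)` and the planted position `ι`, the
counter's coins fit, and the ghost pair avoids the bad event of the union bound (with `ε₁ = 1/(2kε)`,
`δ₁ = 1/kδ`), then the composite oracle's answer `z` satisfies `|z/4^b − |Per X|²| ≤ n!/kε`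
(eqs. (5.93)–(5.95), then rounding to an integer at precision `4^{-b}`, `kε ≤ 4^b`).
[cite: AaronsonArkhipovToC2013, proof of Thm. 1.3, eqs. (5.93)–(5.97) (p. 195)] -/
theorem abs_answer_sub_le {n kε kδ b : ℕ} (hn : 0 < n) (hkε : 0 < kε) (hkδ : 0 < kδ)
    (hb : n + kε + kδ ≤ b)
    (A : Matrix (Fin (n + R.extra n kδ)) (Fin n) ℂ) (ι : Fin n ↪ Fin (n + R.extra n kδ))
    (X : Fin n → Fin n → ℂ) (hA : IsColumnOrthonormal A)
    (hplant : A.submatrix ι id = ((Real.sqrt (n + R.extra n kδ : ℕ))⁻¹ : ℝ) • Matrix.of X)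
    (u₁ u₂ : List Bool) (hu₁ : u₁.length = R.coinLen₁ n b kε kδ)
    (hout : R.H (hidingInput n (R.extra n kδ) b (R.bq n kε kδ) (roundMatrix b (Matrix.of X)) u₁) =
      hidingOutput n (R.extra n kδ) (R.bq n kε kδ) A ι)
    (hlen : (R.idealParams n b kε kδ).stockCoinLen (roundEntries (R.bq n kε kδ) A) ι ≤
      (R.idealParams n b kε kδ).ℓ₂)
    (hgood : ¬ idealBad (R.idealParams n b kε kδ) (1 / (2 * kε)) (1 / kδ) A ι u₂) :
    |((R.gpeIntAnswer n b kε kδ (roundMatrix b (Matrix.of X)) (u₁ ++ u₂) : ℤ) : ℝ) / 4 ^ b -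
        ‖(Matrix.of X).permanent‖ ^ 2| ≤ (n.factorial : ℝ) / kε := by
  haveI : NeZero (n + R.extra n kδ) := ⟨by omega⟩
  set P := R.idealParams n b kε kδ with hP
  set Ecode := roundEntries (R.bq n kε kδ) A with hE
  -- the answer is the rounded rescaled estimate on the ideal-side quantities
  have htake : (u₁ ++ u₂).take (R.coinLen₁ n b kε kδ) = u₁ := List.take_left' hu₁
  have hdrop : (u₁ ++ u₂).drop (R.coinLen₁ n b kε kδ) = u₂ := List.drop_left' hu₁
  have hans : R.gpeIntAnswer n b kε kδ (roundMatrix b (Matrix.of X)) (u₁ ++ u₂) =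
      round ((4 : ℝ) ^ b * ((n.factorial : ℝ) * ((n + R.extra n kδ : ℕ) : ℝ) ^ n *
        ((P.plantedCountEstimate Ecode ι u₂ : ℝ) / 2 ^ P.oracleCoinLen Ecode))) := by
    rw [gpeIntAnswer, if_neg hn.ne', htake, hdrop, hout, rescaledOfOutput,
      R.countOfOutput_hidingOutput n b kε kδ A ι u₂, R.coinLenOfOutput_hidingOutput n b kε kδ A ι]
  -- eqs. (5.93)–(5.95): the rescaled estimate is within `ε₁ n!` of `|Per X|²`
  have hkε' : (0 : ℝ) < kε := by exact_mod_cast hkε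
  have hkδ' : (0 : ℝ) < kδ := by exact_mod_cast hkδ
  have hε : (0 : ℝ) < 1 / (2 * kε) := by positivity
  have hδ : (0 : ℝ) < 1 / kδ := by positivity
  have hkη : 0 < P.kη := by
    show 0 < 32 * kε * kδ
    positivity
  have hα : 1 / (P.kη : ℝ) ≤ 1 / (2 * kε) * (1 / kδ) / 16 := by
    have : (P.kη : ℝ) = 32 * kε * kδ := by
      show ((32 * kε * kδ : ℕ) : ℝ) = _
      push_cast; ring
    rw [this]
    refine le_of_eq ?_
    field_simp
    ring
  have hcore := abs_rescaled_sub_le_of_not_bad P hA ι (Matrix.of X) hplant hε hδ hkη hα hlen hgood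
  -- rounding at precision `4^{-b}`
  set V : ℝ := (n.factorial : ℝ) * ((n + R.extra n kδ : ℕ) : ℝ) ^ n *
    ((P.plantedCountEstimate Ecode ι u₂ : ℝ) / 2 ^ P.oracleCoinLen Ecode) with hV
  have h4 : (0 : ℝ) < 4 ^ b := by positivity
  have hround : |((round ((4 : ℝ) ^ b * V) : ℤ) : ℝ) / 4 ^ b - V| ≤ 1 / (2 * 4 ^ b) := by
    have h1 : |(4 : ℝ) ^ b * V - round ((4 : ℝ) ^ b * V)| ≤ 1 / 2 := abs_sub_round _
    rw [show ((round ((4 : ℝ) ^ b * V) : ℤ) : ℝ) / 4 ^ b - V =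
      -(((4 : ℝ) ^ b * V - round ((4 : ℝ) ^ b * V)) / 4 ^ b) by field_simp; ring]
    rw [abs_neg, abs_div, abs_of_pos h4, div_le_div_iff₀ h4 (by positivity)]
    nlinarith
  -- `1/(2·4^b) ≤ n!/(2kε)` since `kε ≤ b < 4^b` and `1 ≤ n!`
  have hslack : 1 / (2 * (4 : ℝ) ^ b) ≤ (n.factorial : ℝ) / (2 * kε) := by
    have hb4 : (kε : ℝ) ≤ 4 ^ b := by
      have h1 : kε ≤ b := by omega
      have h2 : b < 4 ^ b := Nat.lt_pow_self (by norm_num)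
      exact_mod_cast (h1.trans h2.le)
    have hfac : (1 : ℝ) ≤ n.factorial := by exact_mod_cast Nat.one_le_iff_ne_zero.2 (Nat.factorial_ne_zero n)
    rw [div_le_div_iff₀ (by positivity) (by positivity)]
    nlinarith
  rw [hans]
  calc |((round ((4 : ℝ) ^ b * V) : ℤ) : ℝ) / 4 ^ b - ‖(Matrix.of X).permanent‖ ^ 2|
      = |(((round ((4 : ℝ) ^ b * V) : ℤ) : ℝ) / 4 ^ b - V) + (V - ‖(Matrix.of X).permanent‖ ^ 2)| := by
        congr 1; ring
    _ ≤ |((round ((4 : ℝ) ^ b * V) : ℤ) : ℝ) / 4 ^ b - V| + |V - ‖(Matrix.of X).permanent‖ ^ 2| :=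
        abs_add_le _ _
    _ ≤ 1 / (2 * 4 ^ b) + 1 / (2 * kε) * n.factorial := add_le_add hround hcore
    _ ≤ (n.factorial : ℝ) / (2 * kε) + (n.factorial : ℝ) / (2 * kε) :=
        add_le_add hslack (le_of_eq (by ring))
    _ = (n.factorial : ℝ) / kε := by ring

end ReductionData

/-! ### The real side of Thm. 1.3: `|GPE|²_±` is solved by the composite oracle -/

/-- `log x ≤ x` for `x ≥ 1`, hence `(n⁵/δ) log²(n/δ) ≤ n⁷/δ³`. [folklore] -/
theorem hidingModes_bound {n : ℕ} {δ : ℝ} (hn : 1 ≤ n) (hδ : 0 < δ) (hδ1 : δ ≤ 1) :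
    (n : ℝ) ^ 5 / δ * Real.log (n / δ) ^ 2 ≤ (n : ℝ) ^ 7 / δ ^ 3 := by
  have hn' : (1 : ℝ) ≤ n := by exact_mod_cast hn
  have hx : 1 ≤ (n : ℝ) / δ := by
    rw [le_div_iff₀ hδ]; nlinarith
  have hlog0 : 0 ≤ Real.log ((n : ℝ) / δ) := Real.log_nonneg hx
  have hlog : Real.log ((n : ℝ) / δ) ≤ (n : ℝ) / δ :=
    (Real.log_le_sub_one_of_pos (by positivity)).trans (by linarith)
  have hsq : Real.log ((n : ℝ) / δ) ^ 2 ≤ ((n : ℝ) / δ) ^ 2 := pow_le_pow_left₀ hlog0 hlog 2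
  calc (n : ℝ) ^ 5 / δ * Real.log (n / δ) ^ 2 ≤ (n : ℝ) ^ 5 / δ * ((n : ℝ) / δ) ^ 2 := by
        gcongr
    _ = (n : ℝ) ^ 7 / δ ^ 3 := by field_simp

set_option maxHeartbeats 1600000 in
/-- **Real side of Thm. 1.3 (probabilistic part).** Given Thm. 5.1 (`hTV`), the oracle's guarantee
(Def. 3.11, `h𝒪`), a finite-precision hiding sampler (`hH`), a Stockmeyer counter for the coin
predicate of the oracle (`hS`, from `exists_stockmeyer_counter_samplerRel`) and the bound `hLS` on
the counter's coin demand over orthonormal hidden matrices, the composite oracle solves `|GPE|²_±`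
jointly over the Gaussian input and its coins, for a suitable number of extra modes: the coins split
into the sampler's and the counter's blocks; (H0) turns the former average into `𝒢 ⊗ ν`; the failure
event is contained in the (H3)-bad set, the (H1)-bad set and the bad event of the union bound on the
ghost pair (`abs_answer_sub_le`); Thm. 5.1 moves the latter to `𝒮 ⊗ ν` at cost `Cδ_h ≤ 1/(8kδ)`
(`m ≥ (n⁵/δ_h) log²(n/δ_h)` by the choice of `e`); (H2) transports it to the ideal side, where
`avg_haar_idealBad_le` bounds it by `1/(8kδ) + 1/(4kδ) + 1/(4kδ)`; total `7/(8kδ) < 1/kδ`.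
[cite: AaronsonArkhipovToC2013, Thm. 1.3 (p. 152; proof §5.2 pp. 192–195)] -/
theorem gpeRandOracleSolves_gpeAnswer (hTV : haarUnitaryTruncation_tv) (R : ReductionData)
    (h𝒪 : ∀ (n e b k : ℕ) (U : Matrix (Fin (n + e)) (Fin n) ℂ), IsColumnOrthonormal U → 0 < k →
      R.p₀.eval (n + e + k) ≤ b →
        (oracleSamplePMF R.𝒪 R.c (encodingBosonInput.encode ⟨n, e, b, roundEntries b U⟩) k).tvDist
          (bosonTargetPMF U) ≤ 1 / (k : ℝ))
    (hH : IsHidingSampler R.H R.ℓ₁ R.b₀)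
    (hS : ∀ (x : List Bool) (m kη kδ : ℕ), 0 < kη → 0 < kδ →
      uniformProb (R.cS.eval (x.length + m + kη + kδ))
        {u | ¬ IsApproxCount kη (countWitnesses (samplerRel (oracleRandAlg R.𝒪 R.c)) m x)
          (countEstimate R.F x m kη kδ u)} ≤ 1 / (kδ : ℝ))
    (hLS : ∀ (n e b' kβ' kη' kδS' : ℕ) (A : Matrix (Fin (n + e)) (Fin n) ℂ) (ι : Fin n ↪ Fin (n + e)),
      IsColumnOrthonormal A →
        (⟨R.𝒪, R.c, b', kβ', R.F, R.cS, kη', kδS', 0⟩ : IdealParams).stockCoinLen (roundEntries b' A) ι ≤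
          R.LS.eval (n + e + b' + kβ' + kη' + kδS')) :
    ∃ K : ℕ, GPERandOracleSolves ({ R with K := K } : ReductionData).gpeAnswer := by
  classical
  obtain ⟨C, δ₀, hδ₀, hC⟩ := hTV
  -- the constant `D` controlling `δ_h = 1/(D kδ)`, and the number of extra modes `K (n+1)⁷ kδ³`
  set D : ℕ := 8 * (⌈C⌉₊ + 1) + ⌈1 / δ₀⌉₊ with hD
  set K : ℕ := max 3 (D ^ 3) with hK
  refine ⟨K, ?_⟩
  set R' : ReductionData := { R with K := K } with hR'
  refine ⟨R'.precPoly, R'.coinPoly, fun n kε kδ hkε hkδ => ?_⟩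
  simp only [R'.gpeRandOracleEstimate_gpeAnswer]
  set s : ℕ := n + kε + kδ with hs
  set b : ℕ := R'.precPoly.eval s with hb
  have hkδ' : (0 : ℝ) < kδ := by exact_mod_cast hkδ
  have hkε' : (0 : ℝ) < kε := by exact_mod_cast hkε
  rcases Nat.eq_zero_or_pos n with hn0 | hnpos
  · -- `n = 0`: the answer is exactly `4^b` and `|Per| = 1`, so nothing fails
    subst hn0
    have hempty : ∀ r : List Bool, {X : Fin 0 → Fin 0 → ℂ | ((Nat.factorial 0 : ℕ) : ℝ) / kε <
        |((R'.gpeIntAnswer 0 b kε kδ (roundMatrix b (Matrix.of X)) r : ℤ) : ℝ) / 4 ^ b -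
          ‖(Matrix.of X).permanent‖ ^ 2|} = ∅ := by
      intro r
      ext X
      simp only [Set.mem_setOf_eq, Set.mem_empty_iff_false, iff_false, not_lt,
        ReductionData.gpeIntAnswer, if_true, Matrix.permanent_eq_one_of_card_eq_zero
          (Fintype.card_fin 0)]
      have h4 : (4 : ℝ) ^ b ≠ 0 := by positivity
      simp [h4]
    simp only [hempty, measureReal_empty, Finset.sum_const_zero, zero_div]
    positivity
  -- `n ≥ 1`: set up the parameters
  set e : ℕ := R'.extra n kδ with he
  set b' : ℕ := R'.bq n kε kδ with hb'
  have h : n ≤ n + e := Nat.le_add_right n e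
  have hKge3 : 3 ≤ K := le_max_left _ _
  have hKgeD : D ^ 3 ≤ K := le_max_right _ _
  have he_def : e = K * (n + 1) ^ 7 * kδ ^ 3 := rfl
  have hne : n ≤ e := by
    rw [he_def]
    calc n ≤ n + 1 := Nat.le_succ n
      _ ≤ (n + 1) ^ 7 := Nat.le_self_pow (by norm_num) _
      _ ≤ K * (n + 1) ^ 7 := Nat.le_mul_of_pos_left _ (by omega)
      _ ≤ K * (n + 1) ^ 7 * kδ ^ 3 := Nat.le_mul_of_pos_right _ (by positivity)
  have hne3 : 3 * n ^ 2 ≤ n + e := by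
    rw [he_def]
    have : 3 * n ^ 2 ≤ K * (n + 1) ^ 7 * kδ ^ 3 :=
      calc 3 * n ^ 2 ≤ 3 * (n + 1) ^ 7 := by
            apply Nat.mul_le_mul_left
            calc n ^ 2 ≤ (n + 1) ^ 2 := Nat.pow_le_pow_left (Nat.le_succ n) 2
              _ ≤ (n + 1) ^ 7 := Nat.pow_le_pow_right (by omega) (by norm_num)
        _ ≤ K * (n + 1) ^ 7 := Nat.mul_le_mul_right _ hKge3
        _ ≤ K * (n + 1) ^ 7 * kδ ^ 3 := Nat.le_mul_of_pos_right _ (by positivity)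
    omega
  have hm0 : 0 < n + e := by omega
  haveI : NeZero (n + e) := ⟨hm0.ne'⟩
  have hkH : 0 < ReductionData.kH kδ := by unfold ReductionData.kH; omega
  have hb₀ : R'.b₀.eval (n + e + b' + ReductionData.kH kδ) ≤ b := R'.b₀_le_precPoly n kε kδ
  have hsb : s ≤ b := R'.le_precPoly n kε kδ
  -- instantiate the hiding sampler
  set L₁ : ℕ := R.ℓ₁.eval (n + e + b + b' + ReductionData.kH kδ) with hL₁
  obtain ⟨𝒱, _, ν, _, coins, A, ι, Bad, hH0, hAm, hιm, hBadm, hH1, hBadle, hH2, hH3⟩ :=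
    hH n e b b' (ReductionData.kH kδ) h hnpos hne hkH hb₀
  change 𝒱 → List.Vector Bool L₁ at coins
  change ∀ u : List.Vector Bool L₁, MeasurableSet {v | coins v = u} ∧
    ν.real {v | coins v = u} = 1 / 2 ^ L₁ at hH0
  -- the ideal-side record and its coins
  set P : IdealParams := R'.idealParams n b kε kδ with hP
  have hL₁' : R'.coinLen₁ n b kε kδ = L₁ := rfl
  set M : ℕ := R'.coinPoly.eval s with hM
  set L₂ : ℕ := M - L₁ with hL₂
  have hL₁M : L₁ ≤ M := hL₁' ▸ (R'.coinLen₁_le n kε kδ).trans (R'.polyL1_le_coinPoly s)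
  have hML : M = L₁ + L₂ := by omega
  have hPℓ₂ : P.ℓ₂ = L₂ := rfl
  have hcoinsLen : ∀ v, (coins v).toList.length = L₁ := fun v => by
    rw [List.Vector.toList_length]
  -- the parameters used on the ideal side
  set ε₁ : ℝ := 1 / (2 * kε) with hε₁
  set δ₁ : ℝ := 1 / kδ with hδ₁
  have hε₁pos : 0 < ε₁ := by positivity
  have hδ₁pos : 0 < δ₁ := by positivity
  have hkδS : 0 < P.kδS := by show 0 < 8 * kδ; omega
  have hβ : 1 / (P.kβ : ℝ) ≤ ε₁ * δ₁ / 24 := by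
    have : (P.kβ : ℝ) = 48 * kε * kδ := by
      show ((48 * kε * kδ : ℕ) : ℝ) = _; push_cast; ring
    rw [this, hε₁, hδ₁]; refine le_of_eq ?_; field_simp; ring
  have h𝒪' : ∀ A' : Matrix (Fin (n + e)) (Fin n) ℂ, IsColumnOrthonormal A' →
      (oracleSamplePMF P.𝒪 P.c (encodingBosonInput.encode ⟨n, e, P.b', roundEntries P.b' A'⟩)
          P.kβ).tvDist (bosonTargetPMF A') ≤ 1 / (P.kβ : ℝ) := by
    intro A' hA'
    have hkβ : 0 < ReductionData.kβ kε kδ := by unfold ReductionData.kβ; positivity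
    exact h𝒪 n e b' (ReductionData.kβ kε kδ) A' hA' hkβ le_rfl
  have hS' : ∀ (x : List Bool) (ℓ : ℕ),
      uniformProb (P.cS.eval (x.length + ℓ + P.kη + P.kδS))
        {u | ¬ IsApproxCount P.kη (countWitnesses (samplerRel (oracleRandAlg P.𝒪 P.c)) ℓ x)
          (countEstimate P.F x ℓ P.kη P.kδS u)} ≤ 1 / (P.kδS : ℝ) := by
    intro x ℓ
    have hkη : 0 < ReductionData.kη kε kδ := by unfold ReductionData.kη; positivity
    exact hS x ℓ (ReductionData.kη kε kδ) (ReductionData.kδS kδ) hkη hkδS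
  -- the failure sets, per coin string
  set fail : (Fin n → Fin n → ℂ) → List Bool → Prop := fun X r =>
    (n.factorial : ℝ) / kε <
      |((R'.gpeIntAnswer n b kε kδ (roundMatrix b (Matrix.of X)) r : ℤ) : ℝ) / 4 ^ b -
        ‖(Matrix.of X).permanent‖ ^ 2| with hfail
  set Φ : List Bool → ℝ := fun r => (gaussianMatrixMeasure n).real {X | fail X r} with hΦ
  have hfailm : ∀ r, MeasurableSet {X | fail X r} := fun r => R'.measurableSet_fail n b kε kδ r _
  -- Step 1: split the coins
  have hgoal : (∑ r : List.Vector Bool M, Φ r.toList) / 2 ^ M =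
      (∑ u₂ : List.Vector Bool L₂, (∑ u₁ : List.Vector Bool L₁,
        Φ (u₁.toList ++ u₂.toList)) / 2 ^ L₁) / 2 ^ L₂ := by
    have h1 : ∑ v : List.Vector Bool (L₁ + L₂), Φ v.toList =
        ∑ u₁ : List.Vector Bool L₁, ∑ u₂ : List.Vector Bool L₂, Φ (u₁.toList ++ u₂.toList) := by
      rw [← sum_vector_add_fields L₁ L₂ (fun t d => Φ (t ++ d))]
      exact Finset.sum_congr rfl fun v _ => by rw [List.take_append_drop]
    rw [sum_vector_congr hML Φ, h1, Finset.sum_comm, hML, pow_add, ← Finset.sum_div, div_div]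
  -- the three bad sets on `ℂ^{n×n} × 𝒱`
  set HBad : Set ((Fin n → Fin n → ℂ) × 𝒱) :=
    {p | R.H (hidingInput n e b b' (roundMatrix b (Matrix.of p.1)) (coins p.2).toList) ≠
        hidingOutput n e b' (A p.1 p.2) (ι p.2)} with hHBad
  have hH3' : ((gaussianMatrixMeasure n).prod ν).real HBad ≤ 1 / (ReductionData.kH kδ : ℝ) := hH3
  set E : List.Vector Bool L₂ → Set ((Fin n → Fin n → ℂ) × 𝒱) :=
    fun u₂ => {p | idealBad P ε₁ δ₁ (A p.1 p.2) (ι p.2) u₂.toList} with hEdef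
  have hEm : ∀ u₂, MeasurableSet (E u₂) := fun u₂ =>
    measurableSet_idealBad_prod A ι hAm hιm P ε₁ δ₁ u₂.toList
  -- Step 2: (H0) — the inner average is a `𝒢 ⊗ ν`-probability
  have hstep2 : ∀ u₂ : List.Vector Bool L₂,
      (∑ u₁ : List.Vector Bool L₁, Φ (u₁.toList ++ u₂.toList)) / 2 ^ L₁ =
        ((gaussianMatrixMeasure n).prod ν).real
          {p | p.1 ∈ (fun u₁ : List.Vector Bool L₁ => {X | fail X (u₁.toList ++ u₂.toList)}) (coins p.2)} := by
    intro u₂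
    rw [prod_real_setOf_coins_eq_avg (gaussianMatrixMeasure n) ν coins (fun u => (hH0 u).1)
      (fun u => (hH0 u).2) (fun u₁ => {X | fail X (u₁.toList ++ u₂.toList)}) (fun u₁ => hfailm _)]
  -- Step 3: the deterministic core — failure forces one of the three bad events
  have hincl : ∀ u₂ : List.Vector Bool L₂,
      {p : (Fin n → Fin n → ℂ) × 𝒱 |
        p.1 ∈ (fun u₁ : List.Vector Bool L₁ => {X | fail X (u₁.toList ++ u₂.toList)}) (coins p.2)} ⊆
        HBad ∪ Bad ∪ E u₂ := by
    intro u₂ p hp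
    by_contra hnot
    simp only [Set.mem_union, not_or] at hnot
    obtain ⟨⟨hpH, hpBad⟩, hpE⟩ := hnot
    have hout : R.H (hidingInput n e b b' (roundMatrix b (Matrix.of p.1)) (coins p.2).toList) =
        hidingOutput n e b' (A p.1 p.2) (ι p.2) := by
      by_contra hne'; exact hpH hne'
    obtain ⟨hA, hplant⟩ := hH1 p hpBad
    have hgood : ¬ idealBad P ε₁ δ₁ (A p.1 p.2) (ι p.2) u₂.toList := hpE
    have hlen : P.stockCoinLen (roundEntries b' (A p.1 p.2)) (ι p.2) ≤ P.ℓ₂ := by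
      rw [hP, R'.stockCoinLen_idealParams]
      refine (hLS n e b' _ _ _ (A p.1 p.2) (ι p.2) hA).trans ?_
      exact (R'.LS_le_polyL2 n kε kδ).trans (R'.polyL2_le_coinLen₂ n kε kδ)
    have key := R'.abs_answer_sub_le hnpos hkε hkδ hsb (A p.1 p.2) (ι p.2) p.1 hA hplant
      (coins p.2).toList u₂.toList ((hcoinsLen p.2).trans hL₁'.symm) hout hlen hgood
    simp only [Set.mem_setOf_eq, hfail] at hp
    exact absurd hp (not_lt.2 key)
  -- Step 4: Thm. 5.1 (`δ_h = 1/(D kδ)`) and the choice of `e`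
  have hDpos : 0 < D := by
    have : 8 ≤ 8 * (⌈C⌉₊ + 1) := by omega
    omega
  have hD' : (0 : ℝ) < D := by exact_mod_cast hDpos
  set δh : ℝ := 1 / ((D : ℝ) * kδ) with hδh
  have hδhpos : 0 < δh := by positivity
  have hDge : (8 * (⌈C⌉₊ + 1) : ℝ) + ⌈1 / δ₀⌉₊ = D := by
    rw [hD]; push_cast; ring
  have hδh₀ : δh ≤ δ₀ := by
    have h1 : (1 : ℝ) / δ₀ ≤ ⌈1 / δ₀⌉₊ := Nat.le_ceil _
    have h2 : (⌈1 / δ₀⌉₊ : ℝ) ≤ D := by rw [← hDge]; linarith [show (0:ℝ) ≤ 8 * (⌈C⌉₊ + 1) by positivity]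
    have h3 : (1 : ℝ) ≤ kδ := by exact_mod_cast hkδ
    rw [hδh, div_le_iff₀ (by positivity)]
    calc (1 : ℝ) = 1 / δ₀ * δ₀ := by field_simp
      _ ≤ D * δ₀ := by gcongr; exact h1.trans h2
      _ ≤ D * kδ * δ₀ := by
          have : (D : ℝ) ≤ D * kδ := le_mul_of_one_le_right hD'.le h3
          exact mul_le_mul_of_nonneg_right this hδ₀.le
      _ = δ₀ * (D * kδ) := by ring
  have hδh1 : δh ≤ 1 := by
    rw [hδh, div_le_one (by positivity)]
    have h3 : (1 : ℝ) ≤ kδ := by exact_mod_cast hkδ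
    have h4 : (1 : ℝ) ≤ D := by exact_mod_cast hDpos
    nlinarith
  have hCδ : C * δh ≤ 1 / (8 * kδ) := by
    have h1 : C ≤ ⌈C⌉₊ := Nat.le_ceil C
    have h2 : (8 : ℝ) * (⌈C⌉₊ + 1) ≤ D := by
      rw [← hDge]; linarith [show (0:ℝ) ≤ ⌈1 / δ₀⌉₊ by positivity]
    rw [hδh]
    rw [show C * (1 / ((D : ℝ) * kδ)) = C / (D * kδ) by ring, div_le_div_iff₀ (by positivity) (by positivity)]
    nlinarith [hkδ']
  have hmodes : (n : ℝ) ^ 5 / δh * Real.log (n / δh) ^ 2 ≤ ((n + e : ℕ) : ℝ) := by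
    refine (hidingModes_bound hnpos hδhpos hδh1).trans ?_
    have h1 : (n : ℝ) ^ 7 / δh ^ 3 = (n : ℝ) ^ 7 * (D : ℝ) ^ 3 * (kδ : ℝ) ^ 3 := by
      rw [hδh]; field_simp
    rw [h1]
    have h2 : (n : ℝ) ^ 7 * (D : ℝ) ^ 3 * (kδ : ℝ) ^ 3 ≤ (e : ℝ) := by
      have : n ^ 7 * D ^ 3 * kδ ^ 3 ≤ e := by
        rw [he_def]
        calc n ^ 7 * D ^ 3 * kδ ^ 3 ≤ (n + 1) ^ 7 * K * kδ ^ 3 := by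
              gcongr
              · exact Nat.le_succ n
            _ = K * (n + 1) ^ 7 * kδ ^ 3 := by ring
      exact_mod_cast this
    push_cast
    linarith [show (0 : ℝ) ≤ n by positivity]
  have hclose : TVClose (gaussianMatrixMeasure n) (truncatedHaarMeasure (n + e) n h) (C * δh) :=
    tvClose_gaussian_truncatedHaar hC h hnpos hδhpos hδh₀ hmodes
  -- Step 5: per `u₂`, the union bound, Thm. 5.1 and (H2)
  have hper : ∀ u₂ : List.Vector Bool L₂,
      (∑ u₁ : List.Vector Bool L₁, Φ (u₁.toList ++ u₂.toList)) / 2 ^ L₁ ≤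
        1 / (ReductionData.kH kδ : ℝ) + 1 / (ReductionData.kH kδ : ℝ) + C * δh +
          (∑ ι₀ : Fin n ↪ Fin (n + e),
            (Literature.MathematicalPhysics.QuantumFieldTheory.haarProbability
                (Matrix.unitaryGroup (Fin (n + e)) ℂ)).real
              {U | idealBad P ε₁ δ₁ (firstCols h U) ι₀ u₂.toList}) /
            Fintype.card (Fin n ↪ Fin (n + e)) := by
    intro u₂
    rw [hstep2 u₂]
    have h1 := measureReal_mono (μ := (gaussianMatrixMeasure n).prod ν) (hincl u₂)
    have h2 : ((gaussianMatrixMeasure n).prod ν).real (HBad ∪ Bad ∪ E u₂) ≤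
        ((gaussianMatrixMeasure n).prod ν).real HBad + ((gaussianMatrixMeasure n).prod ν).real Bad +
          ((gaussianMatrixMeasure n).prod ν).real (E u₂) := by
      linarith [measureReal_union_le (μ := (gaussianMatrixMeasure n).prod ν) (HBad ∪ Bad) (E u₂),
        measureReal_union_le (μ := (gaussianMatrixMeasure n).prod ν) HBad Bad]
    have h3 : ((gaussianMatrixMeasure n).prod ν).real (E u₂) ≤
        ((truncatedHaarMeasure (n + e) n h).prod ν).real (E u₂) + C * δh :=
      prod_real_le_add_of_tvClose ν hclose (hEm u₂)
    have h4 : ((truncatedHaarMeasure (n + e) n h).prod ν).real (E u₂) =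
        (∑ ι₀ : Fin n ↪ Fin (n + e),
          (Literature.MathematicalPhysics.QuantumFieldTheory.haarProbability
              (Matrix.unitaryGroup (Fin (n + e)) ℂ)).real
            {U | idealBad P ε₁ δ₁ (firstCols h U) ι₀ u₂.toList}) / Fintype.card (Fin n ↪ Fin (n + e)) :=
      prod_real_idealBad_eq_avg_haar h _ ν A ι hAm hιm hH2 P ε₁ δ₁ u₂.toList
    linarith [h1, h2, h3, h4, hH3', hBadle]
  -- Step 6: average over `u₂` and the ideal-side bound
  have hideal := avg_haar_idealBad_le P h hε₁pos hδ₁pos hne3 hm0 hkδS hβ h𝒪' hS'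
  rw [hPℓ₂] at hideal
  have hV : (0 : ℝ) < 2 ^ L₂ := by positivity
  have hcardV : (Fintype.card (List.Vector Bool L₂) : ℝ) = 2 ^ L₂ := by
    rw [card_vector, Fintype.card_bool]; push_cast; ring
  have havg : (∑ u₂ : List.Vector Bool L₂, (∑ u₁ : List.Vector Bool L₁,
        Φ (u₁.toList ++ u₂.toList)) / 2 ^ L₁) / 2 ^ L₂ ≤
      1 / (ReductionData.kH kδ : ℝ) + 1 / (ReductionData.kH kδ : ℝ) + C * δh +
        (1 / (P.kδS : ℝ) + δ₁ / 4 + δ₁ / 4) := by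
    calc (∑ u₂ : List.Vector Bool L₂, (∑ u₁ : List.Vector Bool L₁,
          Φ (u₁.toList ++ u₂.toList)) / 2 ^ L₁) / 2 ^ L₂
        ≤ (∑ u₂ : List.Vector Bool L₂, (1 / (ReductionData.kH kδ : ℝ) + 1 / (ReductionData.kH kδ : ℝ) +
            C * δh + (∑ ι₀ : Fin n ↪ Fin (n + e),
              (Literature.MathematicalPhysics.QuantumFieldTheory.haarProbability
                  (Matrix.unitaryGroup (Fin (n + e)) ℂ)).real
                {U | idealBad P ε₁ δ₁ (firstCols h U) ι₀ u₂.toList}) /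
              Fintype.card (Fin n ↪ Fin (n + e)))) / 2 ^ L₂ := by
          gcongr with u₂ _
          exact hper u₂
      _ = 1 / (ReductionData.kH kδ : ℝ) + 1 / (ReductionData.kH kδ : ℝ) + C * δh +
            (∑ u₂ : List.Vector Bool L₂, (∑ ι₀ : Fin n ↪ Fin (n + e),
              (Literature.MathematicalPhysics.QuantumFieldTheory.haarProbability
                  (Matrix.unitaryGroup (Fin (n + e)) ℂ)).real
                {U | idealBad P ε₁ δ₁ (firstCols h U) ι₀ u₂.toList}) /
              Fintype.card (Fin n ↪ Fin (n + e))) / 2 ^ L₂ := by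
          rw [Finset.sum_add_distrib, Finset.sum_const, Finset.card_univ, nsmul_eq_mul, hcardV, add_div]
          congr 1
          field_simp
      _ ≤ _ := by linarith [hideal]
  -- Step 7: the budget `2/(16kδ) + 1/(8kδ) + 1/(8kδ) + 1/(4kδ) + 1/(4kδ) = 7/(8kδ) < 1/kδ`
  rw [hgoal]
  refine lt_of_le_of_lt havg ?_
  have hkHr : (ReductionData.kH kδ : ℝ) = 16 * kδ := by
    show ((16 * kδ : ℕ) : ℝ) = _; push_cast; ring
  have hkδSr : (P.kδS : ℝ) = 8 * kδ := by
    show ((8 * kδ : ℕ) : ℝ) = _; push_cast; ring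
  rw [hkHr, hkδSr, hδ₁]
  have : 1 / (16 * (kδ : ℝ)) + 1 / (16 * kδ) + C * δh + (1 / (8 * kδ) + 1 / kδ / 4 + 1 / kδ / 4) ≤
      7 / (8 * kδ) := by
    have h1 : 1 / (16 * (kδ : ℝ)) + 1 / (16 * kδ) + 1 / (8 * kδ) + (1 / (8 * kδ) + 1 / kδ / 4 + 1 / kδ / 4)
        = 7 / (8 * kδ) := by field_simp; ring
    linarith [hCδ]
  refine lt_of_le_of_lt this ?_
  rw [div_lt_div_iff₀ (by positivity) hkδ']
  nlinarith

/-! ### Thm. 1.3 from a hiding sampler and the machine facts (what remains) -/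

/-- **AA13 Thm. 1.3 reduced to the finite-precision Hiding Lemma and two machine facts.** For every
approximate BosonSampling oracle `𝒪` (Def. 3.11), `|GPE|²_± ∈ FBPP^{NP^𝒪}`
(`GPESolvableInFBPPRel (NPRel 𝒪)`, the conclusion of the tree's named fact
`gpeSolvableInFBPPRel_NPRel_of_approxBosonSamplingOracle`) follows from: Thm. 5.1 (`hTV`, the tree's
`haarUnitaryTruncation_tv`, proved from `truncatedHaarDensity`), Stockmeyer's Thm. 4.1 (`hStock`,
proved in the tree), a finite-precision hiding sampler `H ∈ FP` (`hH`, `hHFP` — Lemma 5.8, to be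
constructed), a polynomial bound on the counter's coin demand over orthonormal hidden matrices
(`hLS`, an encoding-length fact) and the `FP^{L}`-membership of the composite oracle for
`F ∈ FP^{L}`, `H ∈ FP` (`hFP`, oracle-machine plumbing). The probabilistic content of §5.2 is
entirely in `gpeRandOracleSolves_gpeAnswer`. [cite: AaronsonArkhipovToC2013, Thm. 1.3 (p. 152; proof §5.2 pp. 192–195)] -/
theorem gpeSolvableInFBPPRel_of_hidingSampler (hTV : haarUnitaryTruncation_tv)
    (hStock : stockmeyerApproxCounting) {𝒪 : Oracle} (h𝒪 : IsApproxBosonSamplingOracle 𝒪)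
    {H : List Bool → List Bool} {ℓ₁ b₀ : Polynomial ℕ} (hH : IsHidingSampler H ℓ₁ b₀) (hHFP : H ∈ FP)
    (hLS : ∀ (c cS : Polynomial ℕ) (F : List Bool → List Bool), ∃ LS : Polynomial ℕ,
      ∀ (n e b' kβ' kη' kδS' : ℕ) (A : Matrix (Fin (n + e)) (Fin n) ℂ) (ι : Fin n ↪ Fin (n + e)),
        IsColumnOrthonormal A →
          (⟨𝒪, c, b', kβ', F, cS, kη', kδS', 0⟩ : IdealParams).stockCoinLen (roundEntries b' A) ι ≤
            LS.eval (n + e + b' + kβ' + kη' + kδS'))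
    (hFP : ∀ (R : ReductionData) (L : Language Bool), R.F ∈ FPRel (Oracle.ofLanguage L) →
      R.H ∈ FP → R.gpeAnswer ∈ FPRel (Oracle.ofLanguage L)) :
    GPESolvableInFBPPRel (NPRel 𝒪) := by
  obtain ⟨p₀, c, h𝒪'⟩ := h𝒪
  obtain ⟨L, hL, F, hF, cS, hS⟩ := exists_stockmeyer_counter_samplerRel hStock 𝒪 c
  obtain ⟨LS, hLS'⟩ := hLS c cS F
  set R : ReductionData := ⟨𝒪, p₀, c, 0, H, ℓ₁, b₀, F, cS, LS⟩ with hR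
  obtain ⟨K, hsolves⟩ := gpeRandOracleSolves_gpeAnswer hTV R h𝒪' hH hS hLS'
  exact ⟨L, hL, _, hFP _ L hF hHFP, hsolves⟩

end Literature.Computability.QuantumComplexity
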